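import Literature.NumberTheory.LFunctions.WeilMarkovQuadratic
import Literature.NumberTheory.LFunctions.WeilGroundState
import Literature.NumberTheory.LFunctions.WeilGroundStateRealZerosProofs
import Literature.NumberTheory.LFunctions.WeilWindowSuzukiProofs
import Literature.NumberTheory.LFunctions.WeilSemilocalCompactnessProofs
import Summits.RiemannHypothesis.RiemannHypothesis.Theorems.WeilWindowFlowWindowLipschitzStubSupBoundAux
import Summits.RiemannHypothesis.RiemannHypothesis.Theorems.WeilWindowFlowWindowLipschitzStubEdgeLawComparisonAux

/-!
# Sub-stub `stub_edgeLaw_comparison` of stub `stub_edgeLaw` of line `cut-dont-squeeze` for crux `WeilWindowFlow.WindowLipschitz`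
(item stmt-RiemannHypothesis-1039, route route-RiemannHypothesis-WeilWindowFlow; registered skeleton rev 4,
`Summits/RiemannHypothesis/RiemannHypothesis/Cruxes/WindowLipschitz/Lines/cut-dont-squeeze.lean`)

**What is proved.** The weak maximum principle with a barrier (P3 of the edge law): from the
barrier `B` of P2 (plateau value `β₀ = (log 1/d₀)^{-1/2}`, profile `(log 1/(a − |x|))^{-1/2}` on the
edge layer `a − d₀ < |x| < a`, with its surplus inequality), finite energy of ground states (C2),
the weak Euler–Lagrange identity (EL) and the uniform sup bound (SB), every Weil ground state `u`
of a window `a ∈ [b₀, A]` obeys the pointwise edge law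
`‖u(x)‖² log(1/(a − |x|)) ≤ K(b₀, A)` a.e. on an edge layer of width `d₀(b₀, A)`.

**Proof route.** For a phase `|ζ| = 1` put `v = ζu`, `V = Re v`, `K₁ = K₀ √(log 1/d₀)` with
`K₀ ≥ ‖u‖_∞` and test (EL) against `W = (V − K₁ B)⁺`; since `K₁ B = K₀` on the plateau, `W`
lives in the edge layer. Real parts: the Markov inequality with the barrier
`(V_p − V_q)(W_p − W_q) ≥ K₁ (B_p − B_q)(W_p − W_q)` bounds the prime atoms below by
`−2K₀ S_A ∫W` and the near archimedean part `t ≤ δ` below by `K₁ ∫₀^δ ρ D_t(B, W) ≥ K₁ σ ∫ W`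
(the surplus of P2, `σ = c√(log 1/d₀) − C(1 + log 1/δ)`); the far part `t > δ` is
`≥ κ_δ ⟨V, W⟩ − 2ρ(δ)‖V‖₁‖W‖₁` (`κ_δ = 2∫_{t>δ} ρ ≥ M_A + ε(b₀) + 1`) and the pole term is
`≥ −4e^{2A}‖v‖₁‖W‖₁`. Collecting, `(K₁σ − O(1)) ∫W ≤ (M_a + ε(a) − κ_δ)⟨V, W⟩ ≤ 0`, so `∫ W = 0`
once `log(1/d₀)` is large, i.e. `Re(ζu) ≤ K₁ B` a.e. (this one-phase step is
`stub_edgeLaw_comparison_phase` of the auxiliary file); the four phases `±1, ±i` give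
`‖u‖² ≤ 2K₁² B² = 2K₀² log(1/d₀) / log(1/(a − |x|))` on the layer. Here: the choice of the
constants `δ, d₀ = e^{-T²}, K = 2K₀²T²`, the bounded representative of `u`, and the four phases.

## References

* P. A. Feulefack, S. Jarohs, T. Weth, *Small order asymptotics of the Dirichlet eigenvalue
  problem for the fractional Laplacian*, arXiv:2010.10448, §3 (the `δ`-decomposition).
* V. Hernández-Santamaría, L. F. López Ríos, A. Saldaña, *Optimal boundary regularity and a
  Hopf-type lemma for Dirichlet problems involving the logarithmic Laplacian*, arXiv:2401.18033,
  Thm 1.1 / Thm 2.4 (barrier and weak maximum principle).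
-/

set_option linter.dupNamespace false

noncomputable section

open MeasureTheory Set Filter
open scoped Topology ENNReal NNReal ComplexConjugate

namespace Summit.RiemannHypothesis.RiemannHypothesis.Theorems.WeilWindowFlowWindowLipschitz

open Literature.NumberTheory.LFunctions

/-- **Sub-stub P3 `stub_edgeLaw_comparison` — the weak maximum principle.**  From the barrier (P2), finite energy (C2),
the Euler–Lagrange identity (EL) and the sup bound (SB): test (EL) with `w = (Re(ζu) − K₁ B)⁺`, `|ζ| = 1`,
`K₁ = C_sup √(log 1/d₀)` (so `w` lives in the layer), δ from `stub_supBound_exists_delta` (`M_A + ε(b₀) + 1 ≤ κ_δ`);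
the Markov inequality with the barrier `(V_p − V_q)(w_p − w_q) ≥ K₁ (B_p − B_q)(w_p − w_q)` (`V = Re ζu`), P2's surplus,
the prime atoms `≥ −2K₁β₀ S_A ∫w`, the far field `≥ κ_δ⟨V,w⟩ − 2ρ(δ)‖u‖₁∫w` and the pole bound give
`[K₁(c√L₀ − C(1+log 1/δ) − 2β₀S_A) − 4e^(2A)(A+½) − 2ρ(δ)(A+½)] ∫ w ≤ (M_a + ε(a) − κ_δ)⟨V,w⟩ ≤ 0`, hence `∫ w = 0` once
`log(1/d₀)` is large; four phases give `‖u‖² ≤ 2K₁² B² = 2C_sup² log(1/d₀)/log(1/(a−|x|))` a.e. on the layer.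
Pattern: `stub_supBound_phase` in `Theorems/WeilWindowFlowWindowLipschitzStubSupBound.lean`
(Feulefack–Jarohs–Weth arXiv:2010.10448 §3; Hernández-Santamaría–López-Ríos–Saldaña arXiv:2401.18033
Thm 1.1 / Thm 2.4). -/
theorem stub_edgeLaw_comparison :
    (∃ c C : ℝ, 0 < c ∧ ∀ a d₀ δ : ℝ, 0 < d₀ → d₀ ≤ 1 / 16 → 2 * d₀ ≤ δ → δ ≤ 1 → δ ≤ a →
      ∃ B : ℝ → ℝ, Measurable B ∧
        (∀ x, 0 ≤ B x ∧ B x ≤ (Real.sqrt (Real.log (1 / d₀)))⁻¹) ∧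
        (∀ x, a ≤ |x| → B x = 0) ∧
        (∀ x, |x| ≤ a - d₀ → B x = (Real.sqrt (Real.log (1 / d₀)))⁻¹) ∧
        (∀ x, a - d₀ < |x| → |x| < a → B x = (Real.sqrt (Real.log (1 / (a - |x|))))⁻¹) ∧
        MemLp (fun x ↦ (B x : ℂ)) 2 ∧
        IntegrableOn (fun t ↦ weilArchDensity t * weilIncrement (fun x ↦ (B x : ℂ)) t) (Ioi 0) ∧
        (∀ w : ℝ → ℝ, MemLp w 2 → (∀ x, 0 ≤ w x) →
          (∀ᵐ x : ℝ, ¬(a - d₀ < |x| ∧ |x| < a) → w x = 0) →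
          IntegrableOn (fun t ↦ weilArchDensity t * weilIncrement (fun x ↦ (w x : ℂ)) t) (Ioi 0) →
          (c * Real.sqrt (Real.log (1 / d₀)) - C * (1 + Real.log (1 / δ))) * ∫ x, w x ≤
            ∫ t in Ioc (0 : ℝ) δ, weilArchDensity t * ∫ x, (B (x + t) - B x) * (w (x + t) - w x))) →
    (∀ (a : ℝ) (u : ℝ → ℂ), IsWeilGroundState a u →
      IntegrableOn (fun t ↦ weilArchDensity t * weilIncrement u t) (Ioi 0) ∧
        weilPoleForm u + weilDirichletEnergy a u ≤
          (weilMarkovConstant a + weilGroundEnergy a) * ∫ x, ‖u x‖ ^ 2) →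
    (∀ (a : ℝ) (u : ℝ → ℂ), IsWeilGroundState a u →
      ∀ w : ℝ → ℂ, MemLp w 2 → (∀ᵐ x : ℝ, x ∉ Icc (-a) a → w x = 0) →
        IntegrableOn (fun t ↦ weilArchDensity t * weilIncrement w t) (Ioi 0) →
        2 * (∫ x, u x * (Real.cosh (x / 2) : ℂ)) * (starRingEnd ℂ) (∫ x, w x * (Real.cosh (x / 2) : ℂ))
          - 2 * (∫ x, u x * (Real.sinh (x / 2) : ℂ)) * (starRingEnd ℂ) (∫ x, w x * (Real.sinh (x / 2) : ℂ))
          + (∑ n ∈ weilPrimeIndex a, (((ArithmeticFunction.vonMangoldt n : ℝ) / Real.sqrt n : ℝ) : ℂ) *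
              ∫ x, (u (x + Real.log n) - u x) * (starRingEnd ℂ) (w (x + Real.log n) - w x))
          + (∫ t in Ioi (0 : ℝ), (weilArchDensity t : ℂ) *
              ∫ x, (u (x + t) - u x) * (starRingEnd ℂ) (w (x + t) - w x))
          - (weilMarkovConstant a : ℂ) * ∫ x, u x * (starRingEnd ℂ) (w x)
        = (weilGroundEnergy a : ℂ) * ∫ x, u x * (starRingEnd ℂ) (w x)) →
    (∀ b₀ A : ℝ, 0 < b₀ → b₀ ≤ A → ∃ K : ℝ, ∀ (a : ℝ) (u : ℝ → ℂ), b₀ ≤ a → a ≤ A →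
      IsWeilGroundState a u → ∀ᵐ x : ℝ, ‖u x‖ ≤ K) →
    ∀ b₀ A : ℝ, 0 < b₀ → b₀ ≤ A → ∃ K d₀ : ℝ, 0 < d₀ ∧ d₀ < 1 ∧
      ∀ (a : ℝ) (u : ℝ → ℂ), b₀ ≤ a → a ≤ A → IsWeilGroundState a u →
        ∀ᵐ x : ℝ, a - d₀ < |x| → |x| < a → ‖u x‖ ^ 2 * Real.log (1 / (a - |x|)) ≤ K := by
  intro hBar hC2 hEL hSB b₀ A hb₀ hbA
  obtain ⟨K, hK⟩ := hSB b₀ A hb₀ hbA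
  obtain ⟨c, C, hc, hBar⟩ := hBar
  obtain ⟨δ₁, hδ₁, hκ₁⟩ :=
    stub_supBound_exists_delta (weilMarkovConstant A + weilGroundEnergy b₀ + 1)
  -- the constants
  set K₀ : ℝ := max K 1 with hK₀
  have hK₀1 : 1 ≤ K₀ := le_max_right _ _
  have hK₀0 : 0 ≤ K₀ := zero_le_one.trans hK₀1
  set δ : ℝ := min δ₁ (min 1 b₀) with hδ
  have hδ0 : 0 < δ := lt_min hδ₁ (lt_min one_pos hb₀)
  have hδ1 : δ ≤ 1 := (min_le_right _ _).trans (min_le_left _ _)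
  have hδb : δ ≤ b₀ := (min_le_right _ _).trans (min_le_right _ _)
  have hκ : weilMarkovConstant A + weilGroundEnergy b₀ + 1 ≤ 2 * ∫ t in Ioi δ, weilArchDensity t := by
    refine hκ₁.trans (mul_le_mul_of_nonneg_left (setIntegral_mono_set
      (integrableOn_weilArchDensity_Ioi hδ0) ?_ (Ioi_subset_Ioi (min_le_left _ _)).eventuallyLE)
      two_pos.le)
    exact (ae_restrict_iff' measurableSet_Ioi).2
      (Eventually.of_forall fun t ht ↦ (weilArchDensity_pos (hδ0.trans ht)).le)
  obtain ⟨Q, hQ⟩ : ∃ Q : ℝ, Q = 4 * Real.exp A ^ 2 * (A + 1 / 2) +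
      2 * (weilArchDensity δ * (A + 1 / 2)) + 2 * K₀ * (∑ n ∈ weilPrimeIndex A,
        ((ArithmeticFunction.vonMangoldt n : ℝ) / Real.sqrt n)) + 1 := ⟨_, rfl⟩
  have hQ0 : 0 ≤ Q := by
    have h1 : 0 ≤ 4 * Real.exp A ^ 2 * (A + 1 / 2) := mul_nonneg (by positivity) (by linarith)
    have h2 : 0 ≤ 2 * (weilArchDensity δ * (A + 1 / 2)) :=
      mul_nonneg two_pos.le (mul_nonneg (weilArchDensity_pos hδ0).le (by linarith))
    have h3 : 0 ≤ 2 * K₀ * ∑ n ∈ weilPrimeIndex A,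
        ((ArithmeticFunction.vonMangoldt n : ℝ) / Real.sqrt n) :=
      mul_nonneg (by positivity) (Finset.sum_nonneg fun n _ ↦
        div_nonneg ArithmeticFunction.vonMangoldt_nonneg (Real.sqrt_nonneg _))
    linarith
  obtain ⟨L₁, hL₁⟩ : ∃ L₁ : ℝ, L₁ = 1 + Real.log (1 / δ) := ⟨_, rfl⟩
  have hL₁0 : 0 ≤ L₁ := by
    have := Real.log_nonneg (one_le_one_div hδ0 hδ1)
    linarith
  have hl16 : 0 ≤ Real.log 16 := Real.log_nonneg (by norm_num)
  have hl2δ : 0 ≤ Real.log (2 / δ) := Real.log_nonneg ((one_le_div hδ0).2 (by linarith))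
  have hCc : 0 ≤ 2 * |C| * L₁ / c := by positivity
  have hQc : 0 ≤ 2 * Q / c := by positivity
  obtain ⟨T, hT⟩ : ∃ T : ℝ,
      T = 1 + Real.log 16 + Real.log (2 / δ) + 2 * |C| * L₁ / c + 2 * Q / c := ⟨_, rfl⟩
  have hT1 : 1 ≤ T := by linarith
  have hT0 : 0 < T := one_pos.trans_le hT1
  -- the surplus beats the sources
  obtain ⟨σ, hσ⟩ : ∃ σ : ℝ, σ = c * T - C * L₁ := ⟨_, rfl⟩
  have hbig : Q ≤ K₀ * T * σ := by
    have h1 : 2 * |C| * L₁ ≤ T * c := (div_le_iff₀ hc).1 (by linarith)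
    have h2 : 2 * Q ≤ T * c := (div_le_iff₀ hc).1 (by linarith)
    have h3 : C * L₁ ≤ |C| * L₁ := mul_le_mul_of_nonneg_right (le_abs_self C) hL₁0
    have hσ2 : Q ≤ σ := by rw [hσ]; linarith
    have h4 : Q ≤ Q * T := le_mul_of_one_le_right hQ0 hT1
    have h5 : Q * T ≤ σ * T := mul_le_mul_of_nonneg_right hσ2 hT0.le
    have h6 : σ * T ≤ K₀ * (σ * T) := le_mul_of_one_le_left (by linarith) hK₀1
    have e : K₀ * T * σ = K₀ * (σ * T) := by ring
    linarith
  rw [hQ] at hbig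
  -- the width of the layer
  set d₀ : ℝ := Real.exp (-(T ^ 2)) with hd₀
  have hd₀0 : 0 < d₀ := Real.exp_pos _
  have hTT : T ≤ T ^ 2 := le_self_pow₀ hT1 two_ne_zero
  have hd₀1 : d₀ < 1 := Real.exp_lt_one_iff.2 (by linarith)
  have hd16 : d₀ ≤ 1 / 16 := by
    have h : d₀ ≤ Real.exp (-Real.log 16) := Real.exp_le_exp.2 (by linarith)
    rwa [Real.exp_neg, Real.exp_log (by norm_num), ← one_div] at h
  have h2d : 2 * d₀ ≤ δ := by
    have h : d₀ ≤ Real.exp (-Real.log (2 / δ)) := Real.exp_le_exp.2 (by linarith)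
    rw [Real.exp_neg, Real.exp_log (by positivity), inv_div] at h
    linarith
  have hlog : Real.log (1 / d₀) = T ^ 2 := by
    rw [hd₀, one_div, ← Real.exp_neg, neg_neg, Real.log_exp]
  have hsq : Real.sqrt (Real.log (1 / d₀)) = T := by rw [hlog, Real.sqrt_sq hT0.le]
  refine ⟨2 * (K₀ * T) ^ 2, d₀, hd₀0, hd₀1, fun a u hba haA hu ↦ ?_⟩
  -- the barrier of the window `a`
  obtain ⟨B, -, hB01, hBout, hBplat, hBlayer, hBL2, hBfin, hSur⟩ :=
    hBar a d₀ δ hd₀0 hd16 h2d hδ1 (hδb.trans hba)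
  rw [hsq] at hB01 hBplat hSur
  rw [← hL₁, ← hσ] at hSur
  -- the bounded representative `u'` vanishing on `|x| ≥ a`
  set u' : ℝ → ℂ := fun x ↦ if ‖u x‖ ≤ K₀ ∧ |x| < a then u x else 0 with hu'
  have hae : u =ᵐ[volume] u' := by
    filter_upwards [hK a u hba haA hu, hu.ae_eq_zero_of_notMem, Measure.ae_ne volume a,
      Measure.ae_ne volume (-a)] with x h1 h2 h3 h4
    show u x = if ‖u x‖ ≤ K₀ ∧ |x| < a then u x else 0
    by_cases hx : |x| < a
    · rw [if_pos ⟨h1.trans (le_max_left _ _), hx⟩]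
    · rw [if_neg fun h ↦ hx h.2]
      refine h2 fun hm ↦ ?_
      have h5 : |x| = a := le_antisymm (abs_le.2 ⟨hm.1, hm.2⟩) (not_lt.1 hx)
      rcases (abs_eq (by linarith)).1 h5 with h | h
      · exact h3 h
      · exact h4 h
  have hu'0 : ∀ x, a ≤ |x| → u' x = 0 := fun x hx ↦ by
    show (if ‖u x‖ ≤ K₀ ∧ |x| < a then u x else 0) = 0
    exact if_neg fun h ↦ (not_lt.2 hx) h.2
  have hu'K : ∀ x, ‖u' x‖ ≤ K₀ := fun x ↦ by
    show ‖(if ‖u x‖ ≤ K₀ ∧ |x| < a then u x else 0)‖ ≤ K₀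
    split_ifs with h
    · exact h.1
    · rw [norm_zero]; exact hK₀0
  -- the four phases
  have key : ∀ ζ : ℂ, ‖ζ‖ = 1 → ∀ᵐ x : ℝ, (ζ * u' x).re ≤ K₀ * T * B x := fun ζ hζ ↦
    stub_edgeLaw_comparison_phase hC2 hEL hb₀ hba haA hδ0 hκ hK₀0 hT0 hbig hB01 hBout hBplat
      hBL2 hBfin hSur ((hu.congr_ae hae).const_mul hζ)
      (fun x hx ↦ show ζ * u' x = 0 by rw [hu'0 x hx, mul_zero])
      fun x ↦ show ‖ζ * u' x‖ ≤ K₀ by rw [norm_mul, hζ, one_mul]; exact hu'K x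
  have h1 := key 1 (by simp)
  have h2 := key (-1) (by simp)
  have h3 := key Complex.I (by simp)
  have h4 := key (-Complex.I) (by simp)
  filter_upwards [h1, h2, h3, h4, hae] with x h1 h2 h3 h4 hx hxl hxr
  rw [hx]
  simp only [one_mul, neg_mul, Complex.neg_re, Complex.mul_re, Complex.I_re, Complex.I_im,
    zero_mul, one_mul, zero_sub, neg_neg] at h1 h2 h3 h4
  have hℓ : 0 < Real.log (1 / (a - |x|)) :=
    Real.log_pos (one_lt_one_div (by linarith) (by linarith))
  have hB2 : B x ^ 2 * Real.log (1 / (a - |x|)) = 1 := by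
    rw [hBlayer x hxl hxr, inv_pow, Real.sq_sqrt hℓ.le, inv_mul_cancel₀ hℓ.ne']
  have hn : ‖u' x‖ ^ 2 ≤ 2 * (K₀ * T * B x) ^ 2 := by
    rw [Complex.sq_norm, Complex.normSq_apply]
    have p1 := mul_nonneg (sub_nonneg.2 h1) (by linarith : 0 ≤ K₀ * T * B x + (u' x).re)
    have p2 := mul_nonneg (sub_nonneg.2 h4) (by linarith : 0 ≤ K₀ * T * B x + (u' x).im)
    linarith
  calc ‖u' x‖ ^ 2 * Real.log (1 / (a - |x|))
      ≤ 2 * (K₀ * T * B x) ^ 2 * Real.log (1 / (a - |x|)) := mul_le_mul_of_nonneg_right hn hℓ.le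
    _ = 2 * (K₀ * T) ^ 2 * (B x ^ 2 * Real.log (1 / (a - |x|))) := by ring
    _ = 2 * (K₀ * T) ^ 2 := by rw [hB2, mul_one]

end Summit.RiemannHypothesis.RiemannHypothesis.Theorems.WeilWindowFlowWindowLipschitz

end
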